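import Mathlib
import Literature.NumberTheory.Irrationality.Zudilin2003.CatalanRecursion
import Literature.NumberTheory.Irrationality.Nesterenko2016.CatalanApproximations
import Summits.KontsevichZagierPeriods.Zeta5Search.KernelKit
import HarnessLib

/-!
# Catalan box family — the `G`-coefficient as an explicit terminating `₃F₂(1)` sum, its exact 2-adic law, kernel certificates

HONEST FRAMING: systematic search; no irrationality claim unless certified.  Cell `pub-zeta5`, seat `fam-catalan`
(`run/shared/lean/pub/pub-zeta5/families/catalan/FAMILY.md` §3, §5.2 and `QSUM.md`).  Nothing in this file is a claim about the
arithmetic nature of Catalan's constant `G`; the kernel certificates are finite exact rational computations (`decide +kernel`,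
no `native_decide`), and the all-parameter statements are recorded as `@[conjecture]`-tagged laws of OURS (one of them proved on
paper, none formalised beyond the finite ranges below).

THE OBJECT.  For non-negative integers `H, J, K, L, M` with Zudilin's ten parameters non-negative
(`H ≤ K+L`, `J ≤ L+M`, `K ≤ M+H`, `L ≤ H+J`) and `S := J+K−M ≥ 1`, the double integral of the tree
`J(H,J,K,L,M) = Literature.NumberTheory.Irrationality.Nesterenko2016.Jsym H J K L M = ∫∫ x^{H−½}(1−x)^J y^L (1−y)^{K−½} (1−xy)^{−S−1} dx dy`
lies in `ℚ G + ℚ` (Zudilin, arXiv:math/0210423, §3, condition (21) and Theorem 3 (ii); Rivoal–Zudilin 2003).  Writing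
`J = Q·G + P`, the seat derived (QSUM.md §1–§2: Beta-series expansion in powers of `xy`, partial fractions, the `G`-part is read off
two elementary series) the CLOSED FORM, with `C := K+L−H`, `g(r) := Γ(½)/Γ(r+½)` (`= 1/(½)_r` for `r ≥ 0`, `(−1)^{|r|}(½)_{|r|}` for `r < 0`):

  `Q(H,J,K,L,M) = 8·(−1)^{H+L+S} (½)_H (½)_K g(H−L) g(H−S) / (S! C!) · ₃F₂(−J, −C, H+½; H−L+½, H−S+½; 1)`,

a terminating hypergeometric sum free of `G` — `catalanQ` below (exact agreement with two independent implementations of the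
linear forms on 245 parameter sets, QSUM.md §3).  CONSEQUENCES recorded here:
* `DiagonalLaw` (kernel-checked for `n ≤ 50` in `diagonal_eq_zudilin_u`): `Q(n,n,n,n,n) = 8(−1)ⁿ u_n` with `u_n` Zudilin's 2003 recursion
  solution `Literature.NumberTheory.Irrationality.Zudilin2003.u` — i.e. the explicit sum satisfies Zudilin's second-order recurrence there;
* `TwoAdicLaw` (F2♯ of FAMILY.md; the `Q`-statement is PROVED on paper in QSUM.md §5.1 — the `i = 0` term of the sum is the unique term of
  minimal 2-adic valuation, by Legendre's formula and Kummer's theorem — and kernel-checked below on the whole parameter box `≤ 6` and on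
  rays): `v₂(Q) = 3 − 2(S+C) + s₂(S) + s₂(C)` (`s₂` = binary digit sum);
* `DyadicLaw` (PROVED ON PAPER by the cell's fam-denom seat, `families/denom/CATK1.md` Theorem A — the sum regrouped over super-Catalan numbers
  `(2k)!(2b)!/(k!b!(k+b)!) ∈ ℤ` and Landau numbers `C(2k,k)C(k,a)/C(2a,a) ∈ ℤ`; 0 exceptions in > 30 000 exact evaluations; kernel-checked here on the
  same ranges; not formalised in general): the reduced denominator of `Q` is a power of `2` (no odd prime), hence with `TwoAdicLaw`
  `den Q = 2^{max(0, 2(S+C)−3−s₂(S)−s₂(C))}` exactly;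
* `CoefficientLaw`: `J = Q·G + P` with `P ∈ ℚ` and `Q = catalanQ` (PROVED on paper, QSUM.md §2; as a Lean statement it only asserts the
  existence of the rational `P`).
-/

namespace Summit.KontsevichZagierPeriods.Zeta5Search.CatalanQSum

open Finset
open Literature.NumberTheory.Irrationality
open Literature.NumberTheory.Irrationality.Nesterenko2016 (Jsym)
open Literature.NumberTheory.Transcendental (catalanConstant)
open Summit.KontsevichZagierPeriods.Zeta5Search.KernelKit

/-! ### Kernel-friendly evaluators -/

/-- Rising factorial `(x)_n = x (x+1) ⋯ (x+n−1)` on `ℚ`, by structural recursion. -/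
def poch (x : ℚ) : ℕ → ℚ
  | 0 => 1
  | n + 1 => poch x n * (x + n)

/-- `poch` is Mathlib's ascending Pochhammer symbol evaluated at `x`. -/
theorem poch_eq (x : ℚ) (n : ℕ) : poch x n = (ascPochhammer ℚ n).eval x := by
  induction n with
  | zero => simp [poch]
  | succ n ih => rw [poch, ih, ascPochhammer_succ_eval]

/-- `g(r) = Γ(½)/Γ(r+½)` for an integer `r`, as the exact rational it is:
`1/(½)_r` for `r ≥ 0` and `(−1)^{−r} (½)_{−r}` for `r < 0`. -/
def gammaHalfRatio (r : ℤ) : ℚ :=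
  if 0 ≤ r then (poch (1 / 2) r.toNat)⁻¹ else (-1) ^ (-r).toNat * poch (1 / 2) (-r).toNat

/-- Term `i` and partial sum `∑_{i' ≤ i}` of the terminating series `₃F₂(−J, −C, a; b₁, b₂; 1)`, built by the term ratio
`t_{i+1}/t_i = (i−J)(i−C)(a+i)/((i+1)(b₁+i)(b₂+i))` (structural recursion; `b₁, b₂` are half-integers in every use, so no
division by zero occurs). -/
def f32Aux (J C : ℕ) (a b₁ b₂ : ℚ) : ℕ → ℚ × ℚ
  | 0 => (1, 1)
  | i + 1 =>
    let p := f32Aux J C a b₁ b₂ i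
    let t := p.1 * (((i : ℚ) - J) * ((i : ℚ) - C) * (a + i)) / (((i : ℚ) + 1) * (b₁ + i) * (b₂ + i))
    (t, p.2 + t)

/-- The terminating `₃F₂(−J, −C, a; b₁, b₂; 1) = ∑_{i=0}^{min(J,C)} (−J)_i (−C)_i (a)_i / (i! (b₁)_i (b₂)_i)`. -/
def f32 (J C : ℕ) (a b₁ b₂ : ℚ) : ℚ := (f32Aux J C a b₁ b₂ (min J C)).2

/-- **The explicit `G`-coefficient of the Catalan box family** (QSUM.md §1′): with `S = J+K−M`, `C = K+L−H`,
`Q(H,J,K,L,M) = 8·(−1)^{H+L+S} (½)_H (½)_K g(H−L) g(H−S)/(S! C!) · ₃F₂(−J, −C, H+½; H−L+½, H−S+½; 1)`.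
(Meaningful on the parameter box `H ≤ K+L, J ≤ L+M, K ≤ M+H, L ≤ H+J, M+1 ≤ J+K`; truncated subtraction elsewhere.) -/
def catalanQ (H J K L M : ℕ) : ℚ :=
  let S := J + K - M
  let C := K + L - H
  8 * (-1) ^ (H + L + S) * poch (1 / 2) H * poch (1 / 2) K
      * gammaHalfRatio ((H : ℤ) - L) * gammaHalfRatio ((H : ℤ) - S) / ((S.factorial : ℚ) * (C.factorial : ℚ))
    * f32 J C ((H : ℚ) + 1 / 2) ((H : ℚ) - L + 1 / 2) ((H : ℚ) - S + 1 / 2)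

/-- Nielsen: `J(0,0,0,0,0) = 8G`; the formula gives `Q = 8` there, and `Q(1,1,1,1,1) = −14`, `Q(2,2,2,2,2) = 649/8`
(Zudilin's `u_1 = 7/4`, `u_2 = 649/64` up to the factor `8(−1)ⁿ`). -/
theorem catalanQ_small_values :
    catalanQ 0 0 0 0 0 = 8 ∧ catalanQ 1 1 1 1 1 = -14 ∧ catalanQ 2 2 2 2 2 = 649 / 8 := by
  decide +kernel

/-! ### Boolean tests -/

/-- The parameter box of the family: Zudilin's ten parameters non-negative and `S = J+K−M ≥ 1`. -/
def inBoxB (H J K L M : ℕ) : Bool :=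
  decide (H ≤ K + L) && decide (J ≤ L + M) && decide (K ≤ M + H) && decide (L ≤ H + J) && decide (M + 1 ≤ J + K)

/-- Parity of the reduced denominator: `true` iff no factor `2` is left in the denominator of `x`. -/
def oddDenB (x : ℚ) : Bool := x.den % 2 == 1

/-- The tests at one parameter set, with `S = J+K−M`, `C = K+L−H`, `σ = s₂(S) + s₂(C)`, `q = Q(H,J,K,L,M)`:
(i) `2^{2(S+C)} q / 8 ∈ ℤ` (denominator of `q` divides `2^{2(S+C)−3}`: no odd prime, `DyadicLaw`, and the 2-adic lower bound);
(ii) `v₂(q) = 3 − 2(S+C) + σ` EXACTLY: `2^{2(S+C)} q / 2^{σ+3}` has odd reduced denominator while `2^{2(S+C)} q / 2^{σ+4}` has not. -/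
def lawOK (H J K L M : ℕ) : Bool :=
  let S := J + K - M
  let C := K + L - H
  let q := catalanQ H J K L M
  let σ := bitsum S + bitsum C
  isIntegerB (2 ^ (2 * (S + C)) * q / 8)
    && oddDenB (2 ^ (2 * (S + C)) * q / 2 ^ (σ + 3)) && !oddDenB (2 ^ (2 * (S + C)) * q / 2 ^ (σ + 4))

/-- Unpacking the tests at one parameter set. -/
theorem lawOK_spec {H J K L M : ℕ} (h : lawOK H J K L M = true) :
    (∃ z : ℤ, (z : ℚ) = 2 ^ (2 * ((J + K - M) + (K + L - H))) * catalanQ H J K L M / 8)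
    ∧ (2 ^ (2 * ((J + K - M) + (K + L - H))) * catalanQ H J K L M
          / 2 ^ (bitsum (J + K - M) + bitsum (K + L - H) + 3)).den % 2 = 1
    ∧ (2 ^ (2 * ((J + K - M) + (K + L - H))) * catalanQ H J K L M
          / 2 ^ (bitsum (J + K - M) + bitsum (K + L - H) + 4)).den % 2 ≠ 1 := by
  simp only [lawOK, Bool.and_eq_true, Bool.not_eq_true', oddDenB, beq_iff_eq, beq_eq_false_iff_ne] at h
  exact ⟨exists_int_of_isIntegerB h.1.1, h.1.2, h.2⟩

/-! ### Kernel certificates -/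

/-- Checker: every parameter set of the box with all five coordinates `≤ B` passes `lawOK`. -/
def boxOK (B : ℕ) : Bool :=
  (List.range (B + 1)).all fun H => (List.range (B + 1)).all fun J => (List.range (B + 1)).all fun K =>
    (List.range (B + 1)).all fun L => (List.range (B + 1)).all fun M => !inBoxB H J K L M || lawOK H J K L M

/-- Soundness of the box checker. -/
theorem lawOK_of_boxOK {B : ℕ} (h : boxOK B = true) {H J K L M : ℕ} (hH : H ≤ B) (hJ : J ≤ B) (hK : K ≤ B)
    (hL : L ≤ B) (hM : M ≤ B) (hb : inBoxB H J K L M = true) : lawOK H J K L M = true := by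
  simp only [boxOK, List.all_eq_true, List.mem_range, Bool.or_eq_true, Bool.not_eq_true'] at h
  rcases h H (by omega) J (by omega) K (by omega) L (by omega) M (by omega) with h1 | h1
  · rw [h1] at hb; exact absurd hb (by decide)
  · exact h1

/-- **The kernel computation on the whole small box** `H, J, K, L, M ≤ 6` (6 419 parameter sets; exact rational arithmetic). -/
theorem boxOK_six : boxOK 6 = true := by
  decide +kernel

/-- The tests pass at EVERY parameter set of the box with `H, J, K, L, M ≤ 6`. -/
theorem lawOK_box6 {H J K L M : ℕ} (hH : H ≤ 6) (hJ : J ≤ 6) (hK : K ≤ 6) (hL : L ≤ 6) (hM : M ≤ 6)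
    (hb : inBoxB H J K L M = true) : lawOK H J K L M = true :=
  lawOK_of_boxOK boxOK_six hH hJ hK hL hM hb

/-- **Read-out on the box `≤ 6`**: at every such parameter set, `2^{2(S+C)−3} Q ∈ ℤ` (no odd prime in the denominator) and
`v₂(Q) = 3 − 2(S+C) + s₂(S) + s₂(C)` exactly (in the odd/even-denominator form of `lawOK_spec`). -/
theorem box6_laws {H J K L M : ℕ} (hH : H ≤ 6) (hJ : J ≤ 6) (hK : K ≤ 6) (hL : L ≤ 6) (hM : M ≤ 6)
    (h1 : H ≤ K + L) (h2 : J ≤ L + M) (h3 : K ≤ M + H) (h4 : L ≤ H + J) (h5 : M + 1 ≤ J + K) :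
    (∃ z : ℤ, (z : ℚ) = 2 ^ (2 * ((J + K - M) + (K + L - H))) * catalanQ H J K L M / 8)
    ∧ (2 ^ (2 * ((J + K - M) + (K + L - H))) * catalanQ H J K L M
          / 2 ^ (bitsum (J + K - M) + bitsum (K + L - H) + 3)).den % 2 = 1
    ∧ (2 ^ (2 * ((J + K - M) + (K + L - H))) * catalanQ H J K L M
          / 2 ^ (bitsum (J + K - M) + bitsum (K + L - H) + 4)).den % 2 ≠ 1 :=
  lawOK_spec (lawOK_box6 hH hJ hK hL hM (by simp only [inBoxB, Bool.and_eq_true, decide_eq_true_eq]; omega))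

/-- **Rays** (the directions documented in FAMILY.md §3/§5): the tests pass along `n·(1,1,1,1,1)` for `n ≤ 50`,
`n·(3,4,4,3,5)`, `n·(4,4,3,4,4)`, `n·(4,3,4,4,4)` for `n ≤ 16`, `n·(2,1,2,2,2)` for `n ≤ 20`, and `n·(4,5,5,4,6)`, `n·(6,6,7,7,8)`,
`n·(7,7,8,8,9)` for `n ≤ 6`. -/
theorem lawOK_rays :
    (∀ n ≤ 50, lawOK n n n n n = true)
    ∧ (∀ n ≤ 16, lawOK (3 * n) (4 * n) (4 * n) (3 * n) (5 * n) = true)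
    ∧ (∀ n ≤ 16, lawOK (4 * n) (4 * n) (3 * n) (4 * n) (4 * n) = true)
    ∧ (∀ n ≤ 16, lawOK (4 * n) (3 * n) (4 * n) (4 * n) (4 * n) = true)
    ∧ (∀ n ≤ 20, lawOK (2 * n) n (2 * n) (2 * n) (2 * n) = true)
    ∧ (∀ n ≤ 6, lawOK (4 * n) (5 * n) (5 * n) (4 * n) (6 * n) = true)
    ∧ (∀ n ≤ 6, lawOK (6 * n) (6 * n) (7 * n) (7 * n) (8 * n) = true)
    ∧ (∀ n ≤ 6, lawOK (7 * n) (7 * n) (8 * n) (8 * n) (9 * n) = true) := by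
  refine ⟨?_, ?_, ?_, ?_, ?_, ?_, ?_, ?_⟩ <;> decide +kernel

/-- **Diagonal = Zudilin 2003**: for `n ≤ 50` the explicit sum equals `8(−1)ⁿ u_n`, `u_n` the solution of Zudilin's recursion
with `u_0 = 1`, `u_1 = 7/4` (`Literature.NumberTheory.Irrationality.Zudilin2003.u`) — kernel-checked exact equality. -/
theorem diagonal_eq_zudilin_u : ∀ n ≤ 50, catalanQ n n n n n = 8 * (-1) ^ n * Zudilin2003.u n := by
  decide +kernel

/-! ### The laws (ours; all-parameter statements, not formalised beyond the ranges above) -/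

/-- **Coefficient law** (OURS, PROVED ON PAPER in QSUM.md §2, exact-checked on 245 parameter sets against two implementations of the
linear forms): on the box, `J(H,J,K,L,M) = Q·G + P` with `Q = catalanQ H J K L M` and some rational `P`.  (Membership of `J` in `ℚG + ℚ` is
Zudilin's Theorem 3 (ii), arXiv:math/0210423; the explicit coefficient is the seat's.) -/
@[conjecture] def CoefficientLaw : Prop :=
  ∀ H J K L M : ℕ, H ≤ K + L → J ≤ L + M → K ≤ M + H → L ≤ H + J → M + 1 ≤ J + K →
    ∃ P : ℚ, Jsym H J K L M = (catalanQ H J K L M : ℝ) * catalanConstant + (P : ℝ)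

/-- **Exact 2-adic law F2♯** (OURS; PROVED ON PAPER for `Q` in QSUM.md §5.1, kernel-checked above on the box `≤ 6` and on rays):
`v₂(Q(H,J,K,L,M)) = 3 − 2(S+C) + s₂(S) + s₂(C)`, `S = J+K−M`, `C = K+L−H`, `s₂` the binary digit sum. -/
@[conjecture] def TwoAdicLaw : Prop :=
  ∀ H J K L M : ℕ, H ≤ K + L → J ≤ L + M → K ≤ M + H → L ≤ H + J → M + 1 ≤ J + K →
    padicValRat 2 (catalanQ H J K L M)
      = 3 - 2 * (((J + K - M : ℕ) : ℤ) + ((K + L - H : ℕ) : ℤ))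
        + ((Nat.digits 2 (J + K - M)).sum : ℤ) + ((Nat.digits 2 (K + L - H)).sum : ℤ)

/-- **Dyadic law** (PROVED ON PAPER by the cell's fam-denom seat, `families/denom/CATK1.md` Theorem A, via super-Catalan and Landau
integrality on a regrouping of this very sum; 0 exceptions in > 30 000 exact evaluations outside Lean; kernel-checked above on the box `≤ 6` and on
rays; not yet formalised in general — the sibling staged file `Zeta5Search/Denom/CatalanBoxArithmetic.lean` proves the two integrality lemmas and
defines the regrouped sum `QClosed`, whose agreement with `catalanQ` is a finite identity to be kernel-checked once both files are in the tree):
the reduced denominator of `Q(H,J,K,L,M)` is a power of `2`. -/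
@[conjecture] def DyadicLaw : Prop :=
  ∀ H J K L M : ℕ, H ≤ K + L → J ≤ L + M → K ≤ M + H → L ≤ H + J → M + 1 ≤ J + K →
    ∃ e : ℕ, (catalanQ H J K L M).den = 2 ^ e

/-- **Diagonal law** (OURS; kernel-checked for `n ≤ 50` above; for all `n` it is a creative-telescoping statement — the explicit sum
satisfies Zudilin's recursion (13) of arXiv:math/0210423 — handed to the cell's recurrence seat): `Q(n,n,n,n,n) = 8(−1)ⁿ u_n`. -/
@[conjecture] def DiagonalLaw : Prop :=
  ∀ n : ℕ, catalanQ n n n n n = 8 * (-1) ^ n * Zudilin2003.u n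

/-- The laws are consistent with the kernel ranges: instances at `(H,J,K,L,M) = (3,4,4,3,5)` (Nesterenko's `0.55` direction) and on
the diagonal. -/
theorem laws_instances :
    lawOK 3 4 4 3 5 = true ∧ lawOK 5 5 5 5 5 = true ∧ catalanQ 5 5 5 5 5 = 8 * (-1) ^ 5 * Zudilin2003.u 5 :=
  ⟨lawOK_rays.2.1 1 (by norm_num), lawOK_rays.1 5 (by norm_num), diagonal_eq_zudilin_u 5 (by norm_num)⟩

end Summit.KontsevichZagierPeriods.Zeta5Search.CatalanQSum
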